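import Summits.Parity.GeneralizedHardyLittlewood.Theorems.FordMaynardSieveConst01651SieveConst01651LinePart09
import HarnessLib

/-!
# Route `FordMaynardSieveConst01651`, target `SieveConst01651` (stmt-Parity-19185): line `sieve_decomposition` re-homed — proofs, part 10 of 11 (file 11 of 12)

File 11 of 12 of the VERBATIM re-homing under `Theorems/` of the registered line skeleton
`Summits/Parity/GeneralizedHardyLittlewood/Cruxes/SieveConst01651/Lines/sieve_decomposition.lean` (v21, sha16
`ada6d0765119a11e`; author seat `linewriter-parity-smallroutes-1`, g0 v1–v20 / g1 v21): Ford–Maynard, Theorem 7.3 (a) at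
`P = (1/2, 0, ν)` with CLOSED support, cut along arXiv:2407.14368 §7.2 / §6.2, composed down to the route target
`Summit.Parity.GeneralizedHardyLittlewood.Theses.FordMaynardSieveConst01651.SieveConst01651`.  Namespace
`Summit.Parity.GeneralizedHardyLittlewood.FordMaynardSieveConst01651SieveDecomposition` (fresh; the `Cruxes` copy keeps its own), files of
≤ 400 lines chained by import; the three registered stubs are replaced by their landed proofs
(`…StubSignClauseFive` p834287, `…StubCertValuePos` p837763, `…TypeIIRegion` p833045), so the skeleton's composition
`SieveConst01651_of_stubs` (last part) is sorry-free.  Mathematics, statements and comments are the linewriter's; this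
re-homing (hand `leafhand-parity-fordmaynardsieveco-2` g4) only moved the definitions (`Eset`, `sliceTest`, `mainG1`, `vk`,
the `Signature.*` statement abbreviations, `Phi`, `innerI`, `jumpSet`, `gval`, `symmExt`, `idxProd`, `gam`) into the first
file, added docstrings where missing, and renamed two unused binders.
Declarations in this part: `exists_abs_Phi_le`, `Phi_chamber_eq_sliceTest`, `sliceSymm_of_chamber`, `integralMainTerm_of`, `window_integral_estimate`, `window_pnt_all`, `window_pnt`, `slice_symm`, `integral_main_term`, `Vsum_integral`, `Vsum_main_term`, `slice_main_term`, `sqfree_main_term`, `main_term`.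

References: [FordMaynard2024PrimeSieves] K. Ford, J. Maynard, *On the theory of prime producing sieves*, arXiv:2407.14368,
Theorem 7.3 (a), Proposition 7.19, §6.2, §7.2, §8.2.
-/

noncomputable section

open Finset
open Literature.NumberTheory.Sieve Literature.NumberTheory.Sieve.FordMaynard Literature.Barriers.Parity.FordMaynard
open Summit.Parity.GeneralizedHardyLittlewood.FordMaynardSieveConst01651SieveConst01651
  (hfun Admissible hfun_apply hfun_of_ne pvec roughPart smoothPart Gwt Hwt window IsRough Nset Rset mem_window mem_Nset mem_Rset
   coneCert openSmall stub_hkPieces stub_coneCertClosed_of_residues' coneCert_signClause_five_of_generic)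

namespace Summit.Parity.GeneralizedHardyLittlewood.FordMaynardSieveConst01651SieveDecomposition

/-- `Φ_k` is bounded (by `sup |𝟙⋆g| / ν^k`). -/
theorem exists_abs_Phi_le {ν : ℝ} (hν : 0 < ν) {g : VecFn} (hs : g.IsSymmetric) (hpc : IsPiecewiseConstOnCone g)
    (k : ℕ) : ∃ M : ℝ, ∀ u, |Phi ν g k u| ≤ M := by
  obtain ⟨S, hS⟩ := exists_abs_starSum_le hs hpc k
  have hS0 : 0 ≤ S := (abs_nonneg _).trans (hS (fun _ => 0))
  have hνk : 0 < ν ^ k := pow_pos hν k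
  refine ⟨S / ν ^ k, fun u => ?_⟩
  unfold Phi
  by_cases hall : ∀ i, ν < u i
  · have hprod : ν ^ k ≤ ∏ i, u i := by
      calc ν ^ k = ∏ _i : Fin k, ν := (Fin.prod_const k ν).symm
        _ ≤ ∏ i, u i := Finset.prod_le_prod (fun i _ => hν.le) (fun i _ => (hall i).le)
    have hprod_pos : 0 < ∏ i, u i := lt_of_lt_of_le hνk hprod
    rw [if_pos hall, abs_div, abs_of_pos hprod_pos, div_le_div_iff₀ hprod_pos hνk]
    calc |starSum g k u| * ν ^ k ≤ S * ν ^ k := by gcongr; exact hS u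
      _ ≤ S * ∏ i, u i := by gcongr
  · rw [if_neg hall, zero_div, abs_zero]; positivity

/-- On the slice `Σ v = 1`, `vᵢ > 0`, `k ≥ 2`: the chamber restriction of `Φ_k` is the `sieveBoundG1` integrand
(`vᵢ < 1 − ν` is automatic). -/
theorem Phi_chamber_eq_sliceTest {ν : ℝ} {g : VecFn} {k : ℕ} (hk : 2 ≤ k) (v : Fin k → ℝ)
    (hv : ∀ i, 0 < v i) (hv1 : ∑ i, v i = 1) :
    (if Monotone v then Phi ν g k v else 0) = sliceTest ν g k v := by
  unfold Phi sliceTest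
  by_cases hmono : Monotone v
  · by_cases hall : ∀ i, ν < v i
    · have hall2 : ∀ i, ν < v i ∧ v i < 1 - ν := by
        intro i
        refine ⟨hall i, ?_⟩
        haveI : Nontrivial (Fin k) := Fin.nontrivial_iff_two_le.mpr hk
        obtain ⟨j, hj⟩ := exists_ne i
        have hpair : v i + v j ≤ ∑ l, v l := by
          rw [← Finset.sum_pair (Ne.symm hj)]
          exact Finset.sum_le_sum_of_subset_of_nonneg (Finset.subset_univ _) fun l _ _ => (hv l).le
        linarith [hall j]
      rw [if_pos hmono, if_pos hall, if_pos ⟨hall2, hmono⟩]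
    · have hn : ¬ ((∀ i, ν < v i ∧ v i < 1 - ν) ∧ Monotone v) := fun h => hall fun i => (h.1 i).1
      rw [if_pos hmono, if_neg hall, if_neg hn, zero_div]
  · have hn : ¬ ((∀ i, ν < v i ∧ v i < 1 - ν) ∧ Monotone v) := fun h => hmono h.2
    rw [if_neg hmono, if_neg hn]

/-- **Stub 1b-β from the chamber symmetrisation** (v18): … -/
theorem sliceSymm_of_chamber (hC : Signature.chamberSymm) : Signature.sliceSymm := by
  intro ν hν hν4 g hadm k hk hkν x
  obtain ⟨hs, hpc, -, -, -⟩ := hadm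
  have ht : (1 : ℕ).primeFactors.card = 0 := by rw [Nat.primeFactors_one, card_empty]
  have hsum : (∑ i, uvec x 1 i) = 0 :=
    sum_eq_zero fun i _ => by exfalso; have hi := i.isLt; omega
  have hI : (fun u : Fin k → ℝ => hfun ν g k ((1 : ℕ).primeFactors.card + k) (Fin.append (uvec x 1) u) / ∏ i, u i)
      = Phi ν g k := by
    funext u; unfold Phi; rw [hfun_append_nil ht]
  obtain ⟨M, hM⟩ := exists_abs_Phi_le hν hs hpc k
  have hC1 := hC k 1 M (Phi ν g k) (measurable_Phi hs hpc ν k) hM (Phi_perm hs k)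
  have hk0 : (k.factorial : ℝ) ≠ 0 := by positivity
  unfold typeITerm
  rw [hsum, sub_zero, hI, hC1, ← mul_assoc, one_div_mul_cancel hk0, one_mul]
  exact sliceIntegral_congr fun v hv hv1 => Phi_chamber_eq_sliceTest hk v hv hv1

/-- **Stub 1b from 1b-β and 1b-γ.** -/
theorem integralMainTerm_of (hβ : Signature.sliceSymm) (hγ : Signature.windowPNT) :
    Signature.integralMainTerm := by
  intro ν hν hν4 g hadm k hk hkK ε hε
  obtain ⟨d, rfl⟩ : ∃ d, k = d + 1 := ⟨k - 1, by omega⟩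
  set sI : ℝ := sliceIntegral (d + 1) 1 (sliceTest ν g (d + 1)) with hsI
  have hε' : 0 < ε / (|sI| + 1) := by positivity
  obtain ⟨x₀, hx₀⟩ := hγ (ε / (|sI| + 1)) hε'
  refine ⟨max x₀ 4, fun x hx => ?_⟩
  have hx4 : 4 ≤ x := le_trans (le_max_right _ _) hx
  have hxx₀ : x₀ ≤ x := le_trans (le_max_left _ _) hx
  have hx0 : 0 < x := by linarith
  have hlogpos : 0 < Real.log x := Real.log_pos (by linarith)
  have hF : (((d + 1).factorial : ℕ) : ℝ) ≠ 0 := by exact_mod_cast (Nat.factorial_pos (d + 1)).ne'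
  rw [primeTupleIntegral_mainG1_eq hν hadm.1 hadm.2.1 d hx4, hβ ν hν hν4 g hadm (d + 1) hk hkK x]
  set I : ℝ := ∫ w in Set.Ioc (Real.log (x / (2 * ((1 : ℕ) : ℝ))) / Real.log x) (Real.log ((⌊x⌋₊ : ℕ) : ℝ) / Real.log x),
    x ^ w / w with hI
  have h1 : 1 / (((d + 1).factorial : ℕ) : ℝ) * ((((d + 1).factorial : ℕ) : ℝ) * sI * I) = sI * I := by
    field_simp
  have hP := hx₀ x hxx₀
  have h0 : 0 ≤ x / Real.log x := div_nonneg hx0.le hlogpos.le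
  rw [h1, ← mul_sub, abs_mul]
  calc |sI| * |I - ((windowPrimes x).card : ℝ)| ≤ |sI| * (ε / (|sI| + 1) * x / Real.log x) :=
        mul_le_mul_of_nonneg_left hP (abs_nonneg _)
    _ = (|sI| / (|sI| + 1)) * ε * (x / Real.log x) := by ring
    _ ≤ 1 * ε * (x / Real.log x) := by
        have : |sI| / (|sI| + 1) ≤ 1 := by rw [div_le_one (by positivity)]; linarith
        exact mul_le_mul_of_nonneg_right (mul_le_mul_of_nonneg_right this hε.le) h0
    _ = ε * x / Real.log x := by ring

/-- The window integral `∫_{(a,b]} x^w/w dw` with `x^a = x/2`, `x^b = ⌊x⌋`: `= x/(2 log x) + O(x/log² x + 1/log x)`. -/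
theorem window_integral_estimate {x a b : ℝ} (hx : 4 ≤ x) (ha : a = Real.log (x / 2) / Real.log x)
    (hb : b = Real.log ((⌊x⌋₊ : ℕ) : ℝ) / Real.log x) :
    |(∫ w in Set.Ioc a b, x ^ w / w) - x / (2 * Real.log x)|
      ≤ x * Real.log 2 / Real.log x ^ 2 + 1 / Real.log x := by
  have hx0 : 0 < x := by linarith
  have hlog2 : 0 < Real.log 2 := Real.log_pos (by norm_num)
  have hL4 : 2 * Real.log 2 ≤ Real.log x := by
    have h := Real.log_le_log (by norm_num) hx
    rw [show (4 : ℝ) = 2 ^ 2 by norm_num, Real.log_pow] at h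
    push_cast at h
    linarith
  have hL : 0 < Real.log x := by linarith
  have hLne : Real.log x ≠ 0 := hL.ne'
  have hF1 : x - 1 < ((⌊x⌋₊ : ℕ) : ℝ) := by
    have := Nat.lt_floor_add_one x
    linarith
  have hFx : ((⌊x⌋₊ : ℕ) : ℝ) ≤ x := Nat.floor_le hx0.le
  have hF0 : 0 < ((⌊x⌋₊ : ℕ) : ℝ) := by linarith
  have hlogx2 : Real.log (x / 2) = Real.log x - Real.log 2 := Real.log_div hx0.ne' two_ne_zero
  have ha' : a = 1 - Real.log 2 / Real.log x := by
    rw [ha, hlogx2]; field_simp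
  have ht : Real.log 2 / Real.log x ≤ 1 / 2 := by rw [div_le_iff₀ hL]; linarith
  have ht0 : 0 ≤ Real.log 2 / Real.log x := by positivity
  have ha0 : 1 / 2 ≤ a := by rw [ha']; linarith
  have ha0pos : 0 < a := by linarith
  have hb1 : b ≤ 1 := by
    rw [hb, div_le_one hL]; exact Real.log_le_log hF0 hFx
  have hab : a ≤ b := by
    rw [ha, hb]
    exact div_le_div_of_nonneg_right (Real.log_le_log (by positivity) (by linarith)) hL.le
  have hxa : x ^ a = x / 2 := by
    rw [ha, Real.rpow_def_of_pos hx0, mul_comm, div_mul_cancel₀ _ hLne, Real.exp_log (by positivity)]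
  have hxb : x ^ b = ((⌊x⌋₊ : ℕ) : ℝ) := by
    rw [hb, Real.rpow_def_of_pos hx0, mul_comm, div_mul_cancel₀ _ hLne, Real.exp_log hF0]
  have hfun : (fun w : ℝ => x ^ w) = fun w => Real.exp (Real.log x * w) := funext fun w => Real.rpow_def_of_pos hx0 w
  have hcont : Continuous (fun w : ℝ => x ^ w) := by
    rw [hfun]; exact Real.continuous_exp.comp (continuous_const.mul continuous_id)
  have hderiv : ∀ w, HasDerivAt (fun w : ℝ => x ^ w / Real.log x) (x ^ w) w := by
    intro w
    have := ((Real.hasStrictDerivAt_const_rpow hx0 w).hasDerivAt).div_const (Real.log x)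
    rwa [mul_div_cancel_right₀ _ hLne] at this
  have hI0 : (∫ w in Set.Ioc a b, x ^ w) = (((⌊x⌋₊ : ℕ) : ℝ) - x / 2) / Real.log x := by
    rw [← intervalIntegral.integral_of_le hab,
      intervalIntegral.integral_eq_sub_of_hasDerivAt (fun w _ => hderiv w) (hcont.intervalIntegrable _ _), hxa, hxb]
    ring
  have hint1 : MeasureTheory.IntegrableOn (fun w : ℝ => x ^ w) (Set.Ioc a b) :=
    (hcont.continuousOn.integrableOn_Icc).mono_set Set.Ioc_subset_Icc_self
  have hcont2 : ContinuousOn (fun w : ℝ => x ^ w / w) (Set.Icc a b) :=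
    hcont.continuousOn.div continuousOn_id fun w hw => (lt_of_lt_of_le ha0pos hw.1).ne'
  have hint2 : MeasureTheory.IntegrableOn (fun w : ℝ => x ^ w / w) (Set.Ioc a b) :=
    hcont2.integrableOn_Icc.mono_set Set.Ioc_subset_Icc_self
  have hint3 : MeasureTheory.IntegrableOn (fun w : ℝ => x ^ w / a) (Set.Ioc a b) :=
    ((hcont.div_const a).continuousOn.integrableOn_Icc).mono_set Set.Ioc_subset_Icc_self
  have hlow : (∫ w in Set.Ioc a b, x ^ w) ≤ ∫ w in Set.Ioc a b, x ^ w / w := by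
    refine MeasureTheory.setIntegral_mono_on hint1 hint2 measurableSet_Ioc fun w hw => ?_
    have hw0 : 0 < w := lt_trans ha0pos hw.1
    rw [le_div_iff₀ hw0]
    exact mul_le_of_le_one_right (Real.rpow_nonneg hx0.le _) (hw.2.trans hb1)
  have hupp : (∫ w in Set.Ioc a b, x ^ w / w) ≤ (∫ w in Set.Ioc a b, x ^ w) / a := by
    rw [← MeasureTheory.integral_div]
    refine MeasureTheory.setIntegral_mono_on hint2 hint3 measurableSet_Ioc fun w hw => ?_
    exact div_le_div_of_nonneg_left (Real.rpow_nonneg hx0.le _) ha0pos hw.1.le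
  rw [hI0] at hlow hupp
  have hTdef : x / (2 * Real.log x) = x / 2 / Real.log x := by rw [div_div]
  rw [hTdef]
  set T : ℝ := x / 2 / Real.log x with hT
  set I : ℝ := ∫ w in Set.Ioc a b, x ^ w / w with hI
  have hT0 : 0 ≤ T := by positivity
  have hI0le : (((⌊x⌋₊ : ℕ) : ℝ) - x / 2) / Real.log x ≤ T :=
    div_le_div_of_nonneg_right (by linarith) hL.le
  have hI0ge : T - 1 / Real.log x ≤ (((⌊x⌋₊ : ℕ) : ℝ) - x / 2) / Real.log x := by
    rw [hT, div_sub_div_same]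
    exact div_le_div_of_nonneg_right (by linarith) hL.le
  have h1a : 1 / a ≤ 1 + 2 * (Real.log 2 / Real.log x) := by
    rw [ha'] at ha0pos ⊢
    rw [div_le_iff₀ ha0pos]
    nlinarith
  rw [abs_sub_le_iff]
  constructor
  · -- upper: `I ≤ I₀/a ≤ T/a ≤ T(1 + 2t)`
    have h2 : (((⌊x⌋₊ : ℕ) : ℝ) - x / 2) / Real.log x / a ≤ T * (1 / a) := by
      rw [← div_eq_mul_one_div]
      exact div_le_div_of_nonneg_right hI0le ha0pos.le
    have h3 : T * (1 / a) ≤ T * (1 + 2 * (Real.log 2 / Real.log x)) := mul_le_mul_of_nonneg_left h1a hT0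
    have h4 : T * (1 + 2 * (Real.log 2 / Real.log x)) - T = x * Real.log 2 / Real.log x ^ 2 := by
      rw [hT]; ring
    have h5 : 0 ≤ 1 / Real.log x := by positivity
    linarith
  · -- lower: `T − I ≤ T − I₀ ≤ 1/log x`
    have h4 : 0 ≤ x * Real.log 2 / Real.log x ^ 2 := by positivity
    linarith

/-- **PNT in the window** (the statement of `stub_windowPNT`; PROVED from the tree's PNT `primeCounting_bounds`
and `window_integral_estimate`). -/
theorem window_pnt_all : ∀ ε : ℝ, 0 < ε → ∃ x₀ : ℝ, ∀ x : ℝ, x₀ ≤ x →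
    |(∫ w in Set.Ioc (Real.log (x / (2 * ((1 : ℕ) : ℝ))) / Real.log x) (Real.log ((⌊x⌋₊ : ℕ) : ℝ) / Real.log x),
        x ^ w / w) - ((windowPrimes x).card : ℝ)| ≤ ε * x / Real.log x := by
  intro ε hε
  obtain ⟨x₁, hx₁⟩ :=
    Literature.Barriers.Parity.FriedlanderGranville.primeCounting_bounds (ε := ε / 4) (by positivity)
  refine ⟨max (max x₁ (2 * x₁)) (max (max 4 (4 / ε)) (Real.exp (16 * Real.log 2 / ε))), fun x hx => ?_⟩
  have hxx₁ : x₁ ≤ x := le_trans (le_trans (le_max_left _ _) (le_max_left _ _)) hx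
  have h2x₁ : 2 * x₁ ≤ x := le_trans (le_trans (le_max_right _ _) (le_max_left _ _)) hx
  have hx4 : 4 ≤ x := le_trans (le_trans (le_trans (le_max_left _ _) (le_max_left _ _)) (le_max_right _ _)) hx
  have hx4ε : 4 / ε ≤ x := le_trans (le_trans (le_trans (le_max_right _ _) (le_max_left _ _)) (le_max_right _ _)) hx
  have hexp : Real.exp (16 * Real.log 2 / ε) ≤ x := le_trans (le_trans (le_max_right _ _) (le_max_right _ _)) hx
  have hx0 : 0 < x := by linarith
  have hlog2 : 0 < Real.log 2 := Real.log_pos (by norm_num)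
  have hL4 : 2 * Real.log 2 ≤ Real.log x := by
    have h := Real.log_le_log (by norm_num) hx4
    rw [show (4 : ℝ) = 2 ^ 2 by norm_num, Real.log_pow] at h
    push_cast at h
    linarith
  have hL : 0 < Real.log x := by linarith
  have hLε : 16 * Real.log 2 / ε ≤ Real.log x := by
    have := Real.log_le_log (Real.exp_pos _) hexp
    rwa [Real.log_exp] at this
  have hLε' : 16 * Real.log 2 ≤ Real.log x * ε := (div_le_iff₀ hε).1 hLε
  have hxε : 4 ≤ x * ε := (div_le_iff₀ hε).1 hx4ε
  rw [Nat.cast_one, mul_one]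
  have hint := window_integral_estimate hx4 rfl rfl
  have hcard := card_windowPrimes_eq hx0.le
  have hA := hx₁ x hxx₁
  have hB := hx₁ (x / 2) (by linarith)
  have hlogx2 : Real.log (x / 2) = Real.log x - Real.log 2 := Real.log_div hx0.ne' two_ne_zero
  have hL2 : Real.log x / 2 ≤ Real.log (x / 2) := by rw [hlogx2]; linarith
  have hL2pos : 0 < Real.log (x / 2) := by linarith
  have hY : x / 2 / Real.log (x / 2) ≤ x / Real.log x := by
    rw [div_le_div_iff₀ hL2pos hL]
    calc x / 2 * Real.log x = x * (Real.log x / 2) := by ring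
      _ ≤ x * Real.log (x / 2) := mul_le_mul_of_nonneg_left hL2 hx0.le
  have hD : |x / 2 / Real.log (x / 2) - x / 2 / Real.log x| ≤ x * Real.log 2 / Real.log x ^ 2 := by
    have hne : Real.log x - Real.log 2 ≠ 0 := by linarith
    have : x / 2 / Real.log (x / 2) - x / 2 / Real.log x = x / 2 * Real.log 2 / (Real.log (x / 2) * Real.log x) := by
      rw [hlogx2]; field_simp; ring
    rw [this, abs_of_nonneg (by positivity), div_le_div_iff₀ (by positivity) (by positivity)]
    calc x / 2 * Real.log 2 * Real.log x ^ 2 = (x * Real.log 2 * Real.log x) * (Real.log x / 2) := by ring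
      _ ≤ (x * Real.log 2 * Real.log x) * Real.log (x / 2) := mul_le_mul_of_nonneg_left hL2 (by positivity)
      _ = x * Real.log 2 * (Real.log (x / 2) * Real.log x) := by ring
  set I : ℝ := ∫ w in Set.Ioc (Real.log (x / 2) / Real.log x) (Real.log ((⌊x⌋₊ : ℕ) : ℝ) / Real.log x), x ^ w / w
    with hI
  set T : ℝ := x / (2 * Real.log x) with hT
  have hTP : |T - ((windowPrimes x).card : ℝ)| ≤ ε / 4 * (x / Real.log x) + (x * Real.log 2 / Real.log x ^ 2 + ε / 4 * (x / Real.log x)) := by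
    have hre : T - ((windowPrimes x).card : ℝ) = (x / Real.log x - (Nat.primeCounting ⌊x⌋₊ : ℝ))
        - (x / 2 / Real.log x - (Nat.primeCounting ⌊x / 2⌋₊ : ℝ)) := by
      rw [hcard, hT]; field_simp; ring
    rw [hre]
    refine (abs_sub _ _).trans (add_le_add ?_ ?_)
    · rw [abs_sub_comm]; exact hA
    · calc |x / 2 / Real.log x - (Nat.primeCounting ⌊x / 2⌋₊ : ℝ)|
          ≤ |x / 2 / Real.log x - x / 2 / Real.log (x / 2)| + |x / 2 / Real.log (x / 2) - (Nat.primeCounting ⌊x / 2⌋₊ : ℝ)| :=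
            abs_sub_le _ _ _
        _ ≤ x * Real.log 2 / Real.log x ^ 2 + ε / 4 * (x / Real.log x) := by
            refine add_le_add ?_ ?_
            · rw [abs_sub_comm]; exact hD
            · rw [abs_sub_comm]
              exact hB.trans (mul_le_mul_of_nonneg_left hY (by positivity))
  have hE1 : 2 * (x * Real.log 2 / Real.log x ^ 2) ≤ ε / 4 * (x / Real.log x) := by
    rw [show 2 * (x * Real.log 2 / Real.log x ^ 2) = 2 * x * Real.log 2 / Real.log x ^ 2 by ring,
      show ε / 4 * (x / Real.log x) = ε / 4 * x / Real.log x by ring,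
      div_le_div_iff₀ (by positivity) hL]
    calc 2 * x * Real.log 2 * Real.log x = (x * Real.log x) * (2 * Real.log 2) := by ring
      _ ≤ (x * Real.log x) * (ε * Real.log x / 4) :=
          mul_le_mul_of_nonneg_left (by linarith) (by positivity)
      _ = ε / 4 * x * Real.log x ^ 2 := by ring
  have hE2 : 1 / Real.log x ≤ ε / 4 * (x / Real.log x) := by
    rw [show ε / 4 * (x / Real.log x) = (ε / 4 * x) / Real.log x by ring]
    exact div_le_div_of_nonneg_right (by linarith) hL.le
  calc |I - ((windowPrimes x).card : ℝ)| ≤ |I - T| + |T - ((windowPrimes x).card : ℝ)| := abs_sub_le _ _ _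
    _ ≤ (x * Real.log 2 / Real.log x ^ 2 + 1 / Real.log x)
        + (ε / 4 * (x / Real.log x) + (x * Real.log 2 / Real.log x ^ 2 + ε / 4 * (x / Real.log x))) :=
          add_le_add hint hTP
    _ ≤ ε * x / Real.log x := by
          have : ε * x / Real.log x = 4 * (ε / 4 * (x / Real.log x)) := by ring
          rw [this]; linarith

/-- **Stub 1b-γ** (former stub; PROVED in v17). -/
theorem window_pnt : Signature.windowPNT := window_pnt_all

/-- Former stub (PROVED here; see the card). -/
theorem slice_symm : Signature.sliceSymm := sliceSymm_of_chamber chamber_symm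

/-- **Stub 1b** (former stub; PROVED in full, v16–v19). -/
theorem integral_main_term : Signature.integralMainTerm := integralMainTerm_of slice_symm window_pnt

/-- Former stub (PROVED here; see the card). -/
theorem Vsum_integral : Signature.VsumIntegral := VsumIntegral_of_injSum injSum_integral

/-- Former stub (PROVED here; see the card). -/
theorem Vsum_main_term : Signature.VsumMainTerm := VsumMainTerm_of Vsum_integral integral_main_term

/-- Former stub (PROVED here; see the card). -/
theorem slice_main_term : Signature.sliceMainTerm := sliceMainTerm_of_Vsum Vsum_main_term

/-- Former stub (PROVED here; see the card). -/
theorem sqfree_main_term : Signature.sqfreeMainTerm := sqfreeMainTerm_of_slice slice_main_term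

/-- Former stub (PROVED here; see the card). -/
theorem main_term : Signature.mainTerm := mainTerm_of_sqfree sqfree_main_term

end Summit.Parity.GeneralizedHardyLittlewood.FordMaynardSieveConst01651SieveDecomposition

end
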